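import Mathlib
import Literature.Analysis.FluidPDE.StretchedLayerNS
import Summits.AnomalousDissipation.AnomalousDissipation.Theorems.MarginalStabilityChainStretchedVortexRowsStubPressureReconstructionTools
import HarnessLib

/-!
# Tools for the dissipation read-out of a stretched vortex row

Helper file for the stub `stub_dissipationReadOut` of the line
`braid-closed-large-circulation-gluing` (crux `stmt-AnomalousDissipation-3009`,
`MarginalStabilityChain.StretchedVortexRows`), which reads the dissipation
`layerDissipation ν L u v = (ν/L)∫⁻∫⁻ |∇(u,v)|²` of an `x`-periodic, divergence-free, exponentially
decaying `C²` velocity field off the cell enstrophy `(ν/L)∫∫ ω²`.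

The slice-derivative dictionary (`StretchedLayer.dX/dY` versus Mathlib's `fderiv` of the uncurried
field, `hasDerivAt_dX/dY`, `contDiff_dX/dY`, Schwarz `dX_dY_comm`, continuity of slices) is the
sibling file `…StubPressureReconstructionTools` (namespace `…PressureTools`), imported here; this
file only adds what the read-out needs on top of it:

* `continuous_dX`, `continuous_dY`: the slice-derivative fields of a jointly `C¹` field are
  continuous (order-zero case of `PressureTools.contDiff_dX_of_le`).
* `integrable_exp_neg_mul_abs`, `integrable_strip`: `e^{-b|y|}` is integrable on `ℝ`, and a
  continuous plane function dominated by `C e^{-b|y|}` is integrable on the period strip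
  `(0, L] × ℝ` (Lebesgue restricted to `(0, L]`, times Lebesgue).
* `sq_envelope`, `abs_jac_le`, `vort_sq_le`, `grad_sq_le`: the pointwise algebra turning the
  decay package `|uₓ| + |u_y| + |vₓ| + |v_y| ≤ C'e^{-a|y|}` into bounds `≤ C'²e^{-2a|y|}` for the
  Jacobian `uₓv_y - u_yvₓ`, the enstrophy density `(vₓ - u_y)²` and the gradient density.
* `stub_dissipationReadOut_mixedPartials` — the registered helper stub (Schwarz for `dX/dY`),
  proved by `PressureTools.dX_dY_comm`.

Everything here is standard calculus; no sources beyond Mathlib.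
-/

-- summit and problem are both named `AnomalousDissipation`, so every name repeats the component
set_option linter.dupNamespace false

noncomputable section

open scoped Topology ContDiff ENNReal
open Filter Set Function MeasureTheory

namespace Summit.AnomalousDissipation.AnomalousDissipation.Theorems
namespace MarginalStabilityChainStretchedVortexRows

namespace DissipationReadOut

open Literature.Analysis.FluidPDE Literature.Analysis.FluidPDE.StretchedLayer PressureTools

/-! ### Continuity of the slice-derivative fields -/

variable {f : ℝ → ℝ → ℝ}

/-- `∂ₓ f` of a jointly `C¹` plane field is continuous on the plane. [folklore] -/
theorem continuous_dX (hf : ContDiff ℝ 1 (fun q : ℝ × ℝ => f q.1 q.2)) :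
    Continuous (fun q : ℝ × ℝ => dX f q.1 q.2) :=
  (contDiff_dX_of_le (m := 0) hf (by simp)).continuous

/-- `∂_y f` of a jointly `C¹` plane field is continuous on the plane. [folklore] -/
theorem continuous_dY (hf : ContDiff ℝ 1 (fun q : ℝ × ℝ => f q.1 q.2)) :
    Continuous (fun q : ℝ × ℝ => dY f q.1 q.2) :=
  (contDiff_dY_of_le (m := 0) hf (by simp)).continuous

/-! ### Integrability on the period strip and the pointwise decay algebra -/

/-- `t ↦ e^{-b|t|}` is integrable on `ℝ` for `b > 0` (Mathlib `integrableOn_exp_mul_Iic/Ioi` on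
the two half-lines). [folklore] -/
theorem integrable_exp_neg_mul_abs {b : ℝ} (hb : 0 < b) :
    Integrable (fun t : ℝ => Real.exp (-b * |t|)) := by
  rw [← integrableOn_univ, ← Iic_union_Ioi (a := (0 : ℝ)), integrableOn_union]
  constructor
  · refine (integrableOn_exp_mul_Iic hb 0).congr_fun (fun t ht => ?_) measurableSet_Iic
    simp only
    rw [abs_of_nonpos ht]
    ring_nf
  · refine (integrableOn_exp_mul_Ioi (neg_lt_zero.2 hb) 0).congr_fun (fun t ht => ?_)
      measurableSet_Ioi
    simp only
    rw [abs_of_pos (mem_Ioi.1 ht)]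

/-- A continuous function on the plane dominated by `C e^{-b|y|}`, `b > 0`, is integrable on
every period strip `(0, L] × ℝ` (Lebesgue restricted to `(0, L]`, times Lebesgue). [folklore] -/
theorem integrable_strip {G : ℝ × ℝ → ℝ} (hG : Continuous G) {C b : ℝ} (hb : 0 < b)
    (hbound : ∀ q, |G q| ≤ C * Real.exp (-b * |q.2|)) (L : ℝ) :
    Integrable G ((volume.restrict (Ioc 0 L)).prod volume) := by
  refine Integrable.mono' (g := fun q : ℝ × ℝ => C * Real.exp (-b * |q.2|)) ?_
    hG.aestronglyMeasurable (ae_of_all _ fun q => ?_)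
  · exact (integrable_const C).mul_prod (integrable_exp_neg_mul_abs hb)
  · rw [Real.norm_eq_abs]
    exact hbound q

/-- Squaring the decay envelope: `(C e^{-a|y|})² = C² e^{-2a|y|}`. [folklore] -/
theorem sq_envelope (C a y : ℝ) :
    (C * Real.exp (-a * |y|)) ^ 2 = C ^ 2 * Real.exp (-(2 * a) * |y|) := by
  have h : -(2 * a) * |y| = -a * |y| + -a * |y| := by ring
  rw [h, Real.exp_add]
  ring

/-- If `|p| + |q| + |r| + |s| ≤ M` then the Jacobian-type expression `p s - q r` has size at
most `M²`. [folklore] -/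
theorem abs_jac_le {p q r s M : ℝ} (h : |p| + |q| + |r| + |s| ≤ M) :
    |p * s - q * r| ≤ M ^ 2 := by
  have h1 : |p * s - q * r| ≤ |p| * |s| + |q| * |r| := by
    calc |p * s - q * r| ≤ |p * s| + |q * r| := abs_sub _ _
      _ = |p| * |s| + |q| * |r| := by rw [abs_mul, abs_mul]
  have hM : |p| + |q| + |r| + |s| ≥ 0 := by positivity
  nlinarith [abs_nonneg p, abs_nonneg q, abs_nonneg r, abs_nonneg s,
    mul_nonneg (abs_nonneg p) (abs_nonneg q), mul_nonneg (abs_nonneg p) (abs_nonneg r),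
    mul_nonneg (abs_nonneg q) (abs_nonneg s), mul_nonneg (abs_nonneg r) (abs_nonneg s),
    mul_nonneg hM (hM.le.trans h)]

/-- If `|p| + |q| + |r| + |s| ≤ M` then `(r - q)² ≤ M²`. [folklore] -/
theorem vort_sq_le {p q r s M : ℝ} (h : |p| + |q| + |r| + |s| ≤ M) : (r - q) ^ 2 ≤ M ^ 2 := by
  have h1 : |r - q| ≤ M := (abs_sub r q).trans (by linarith [abs_nonneg p, abs_nonneg s])
  have h2 : |r - q| ^ 2 ≤ M ^ 2 := pow_le_pow_left₀ (abs_nonneg _) h1 2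
  rwa [sq_abs] at h2

/-- If `|p| + |q| + |r| + |s| ≤ M` then `p² + q² + r² + s² ≤ M²`. [folklore] -/
theorem grad_sq_le {p q r s M : ℝ} (h : |p| + |q| + |r| + |s| ≤ M) :
    p ^ 2 + q ^ 2 + r ^ 2 + s ^ 2 ≤ M ^ 2 := by
  have hM : |p| + |q| + |r| + |s| ≥ 0 := by positivity
  have h2 : (|p| + |q| + |r| + |s|) ^ 2 ≤ M ^ 2 := pow_le_pow_left₀ hM h 2
  nlinarith [abs_nonneg p, abs_nonneg q, abs_nonneg r, abs_nonneg s, sq_abs p, sq_abs q,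
    sq_abs r, sq_abs s]

end DissipationReadOut

open Literature.Analysis.FluidPDE Literature.Analysis.FluidPDE.StretchedLayer in
/-- **Schwarz for slice derivatives** (registered on stmt-AnomalousDissipation-3009 as the helper
stub `stub_dissipationReadOut_mixedPartials` of `stub_dissipationReadOut`): for a jointly `C²`
curried plane field `f x y`, `∂ₓ ∂_y f = ∂_y ∂ₓ f` pointwise. This is the sibling file's
`PressureTools.dX_dY_comm` (Mathlib `ContDiffAt.isSymmSndFDerivAt`). [folklore] -/
theorem stub_dissipationReadOut_mixedPartials :
    ∀ (f : ℝ → ℝ → ℝ), ContDiff ℝ 2 (fun q : ℝ × ℝ => f q.1 q.2) →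
      ∀ x y : ℝ, dX (dY f) x y = dY (dX f) x y :=
  fun _ hf x y => PressureTools.dX_dY_comm hf x y

end MarginalStabilityChainStretchedVortexRows
end Summit.AnomalousDissipation.AnomalousDissipation.Theorems

end
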